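import Mathlib
import HarnessLib
import Summits.NavierStokesRegularity.NavierStokesRegularity.Theorems.UnthreadedRigidityDoorUnthreadedRigidityVirialHornShellFields
import Summits.NavierStokesRegularity.NavierStokesRegularity.Theorems.UnthreadedRigidityDoorUnthreadedRigidityPolyhedralIsotropicField
import Summits.NavierStokesRegularity.NavierStokesRegularity.Theorems.UnthreadedRigidityDoorUnthreadedRigidityPersistenceGradSqAffineMeridian
import Literature.Analysis.FluidPDE.AxisymmetricReflection

/-!
# Route `UnthreadedRigidityDoor`, wall item W2 `UnthreadedRigidity` (stmt-NavierStokesRegularity-27585) — LINE g12-2 «PERSISTENCE FILTER»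
# (ns-idea-6 g12, `Persistence_sketch.lean` 09bc8f71301208c4): SPHERE TOOLS for the support S–M «SPHERE LAW» `BalanceSphereLaw`

Seat ns-es-p1 g9.  Two elementary facts about functions on spheres `S_r = {|y| = r}` in `ℝ³`, no Riemannian geometry:

(great circles `cos t·y + sin t·w`: `hasDerivAt_gamma` of `…PersistenceGradSqAffineMeridian`, `Literature.Analysis.FluidPDE.exists_cos_eq_sin_eq`)

* `fderiv_eq_zero_of_vanish_on_sphere` — a differentiable function that VANISHES on `S_r` has RADIAL gradient there: `Dg(y)v = 0` for `v ⊥ y`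
  (differentiate `g` along the great circle `cos t·y + sin t·w`);
* `eq_of_cross_gradient_eq_zero_on_sphere` — a function whose gradient is RADIAL on `S_r` (`∇f(y) × y = 0`) is CONSTANT on `S_r`
  (BAC–CAB: `|y|²∇f = ⟪y,∇f⟫y`, so `f` has zero derivative along every great-circle arc; any two points of `S_r` lie on one).

HONEST LABEL: calculus helpers for a support of a files-only RUNG line; nothing here bears on `UnthreadedRigidity` (27585), W2 or NS regularity.  0 kit.
[folklore]
-/

noncomputable section

-- the summit and its single sub-problem share the name (CONVENTIONS §1), as in every Theorems file
set_option linter.dupNamespace false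

namespace Summit.NavierStokesRegularity.NavierStokesRegularity.Theorems.UnthreadedRigidity.Persistence

open Set Function Filter Topology
open scoped RealInnerProductSpace
open Literature.Analysis.FluidPDE (cross cross_cross_right cross_smul_right exists_cos_eq_sin_eq)
open Summit.NavierStokesRegularity.NavierStokesRegularity.Theorems.UnthreadedRigidity.ProfileHorn (E3)
open Summit.NavierStokesRegularity.NavierStokesRegularity.Theorems.UnthreadedRigidity.Polyhedral (exists_perp_perp)

/-! ## §1 Great circles -/

/-- on an orthogonal pair of vectors of length `r` the great circle stays on `S_r`. [folklore] -/
theorem norm_greatCircle {y w : E3} {r : ℝ} (hy : ‖y‖ = r) (hw : ‖w‖ = r) (hyw : ⟪y, w⟫ = 0) (t : ℝ) :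
    ‖Real.cos t • y + Real.sin t • w‖ = r := by
  have hr : 0 ≤ r := by rw [← hy]; exact norm_nonneg _
  have hwy : ⟪w, y⟫ = 0 := by rw [real_inner_comm]; exact hyw
  have hyy : ⟪y, y⟫ = r ^ 2 := by rw [real_inner_self_eq_norm_sq, hy]
  have hww : ⟪w, w⟫ = r ^ 2 := by rw [real_inner_self_eq_norm_sq, hw]
  have hsq : ‖Real.cos t • y + Real.sin t • w‖ ^ 2 = r ^ 2 := by
    rw [← real_inner_self_eq_norm_sq]
    simp only [inner_add_left, inner_add_right, real_inner_smul_left, real_inner_smul_right, hyw, hwy, hyy, hww]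
    have := Real.sin_sq_add_cos_sq t
    linear_combination r ^ 2 * this
  have h := (sq_eq_sq₀ (norm_nonneg _) hr).1 hsq
  exact h

/-- the velocity of the great circle is orthogonal to the position. [folklore] -/
theorem inner_greatCircle_velocity {y w : E3} {r : ℝ} (hy : ‖y‖ = r) (hw : ‖w‖ = r) (hyw : ⟪y, w⟫ = 0) (t : ℝ) :
    ⟪Real.cos t • y + Real.sin t • w, -Real.sin t • y + Real.cos t • w⟫ = 0 := by
  have hwy : ⟪w, y⟫ = 0 := by rw [real_inner_comm]; exact hyw
  have hyy : ⟪y, y⟫ = r ^ 2 := by rw [real_inner_self_eq_norm_sq, hy]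
  have hww : ⟪w, w⟫ = r ^ 2 := by rw [real_inner_self_eq_norm_sq, hw]
  simp only [inner_add_left, inner_add_right, real_inner_smul_left, real_inner_smul_right, hyw, hwy, hyy, hww]
  ring

/-- ANY TWO POINTS OF `S_r` LIE ON A GREAT CIRCLE: for `|y₁| = |y₂| = r > 0` there are `w ⊥ y₁` with `|w| = r` and an angle `θ` with
`y₂ = cos θ·y₁ + sin θ·w`. [folklore] -/
theorem exists_greatCircle_through {y₁ y₂ : E3} {r : ℝ} (hr : 0 < r) (h₁ : ‖y₁‖ = r) (h₂ : ‖y₂‖ = r) :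
    ∃ (w : E3) (θ : ℝ), ‖w‖ = r ∧ ⟪y₁, w⟫ = 0 ∧ y₂ = Real.cos θ • y₁ + Real.sin θ • w := by
  have hr0 : r ≠ 0 := hr.ne'
  have hy₁ : ⟪y₁, y₁⟫ = r ^ 2 := by rw [real_inner_self_eq_norm_sq, h₁]
  -- the component of `y₂` orthogonal to `y₁`
  set c : ℝ := ⟪y₁, y₂⟫ / r ^ 2 with hc
  set v : E3 := y₂ - c • y₁ with hv
  have hv1 : ⟪y₁, v⟫ = 0 := by
    rw [hv, inner_sub_right, real_inner_smul_right, hy₁, hc]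
    field_simp
    ring
  have hpy : c ^ 2 * r ^ 2 + ‖v‖ ^ 2 = r ^ 2 := by
    have e : y₂ = c • y₁ + v := by rw [hv]; abel
    have h : ‖y₂‖ ^ 2 = ‖c • y₁ + v‖ ^ 2 := by rw [← e]
    have hvy : ⟪v, y₁⟫ = 0 := by rw [real_inner_comm]; exact hv1
    have hvv : ⟪v, v⟫ = ‖v‖ ^ 2 := real_inner_self_eq_norm_sq v
    rw [← real_inner_self_eq_norm_sq (c • y₁ + v), h₂] at h
    simp only [inner_add_left, inner_add_right, real_inner_smul_left, real_inner_smul_right, hy₁, hv1, hvy, hvv] at h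
    linarith
  by_cases hv0 : v = 0
  · -- `y₂ = ± y₁`: use any `w ⊥ y₁`
    obtain ⟨b, hb0, hb1, -⟩ := exists_perp_perp y₁ y₁
    have hbn : ‖b‖ ≠ 0 := norm_ne_zero_iff.2 hb0
    set w : E3 := (r / ‖b‖) • b with hw
    have hwn : ‖w‖ = r := by
      rw [hw, norm_smul, Real.norm_eq_abs, abs_div, abs_of_pos hr, abs_of_nonneg (norm_nonneg _), div_mul_cancel₀ _ hbn]
    have hyw : ⟪y₁, w⟫ = 0 := by rw [hw, real_inner_smul_right, hb1, mul_zero]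
    have hc1 : c ^ 2 = 1 := by
      have : ‖v‖ = 0 := by rw [hv0, norm_zero]
      rw [this] at hpy
      have h' : (c ^ 2 - 1) * r ^ 2 = 0 := by linarith
      rcases mul_eq_zero.1 h' with h' | h'
      · linarith
      · exact absurd h' (pow_ne_zero 2 hr0)
    have hy₂ : y₂ = c • y₁ := by
      have : y₂ - c • y₁ = 0 := by rw [← hv]; exact hv0
      exact sub_eq_zero.1 this
    have hc2 : (c - 1) * (c + 1) = 0 := by linear_combination hc1
    rcases mul_eq_zero.1 hc2 with hc' | hc'
    · have hc'' : c = 1 := by linarith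
      refine ⟨w, 0, hwn, hyw, ?_⟩
      rw [Real.cos_zero, Real.sin_zero, hy₂, hc'', zero_smul, add_zero]
    · have hc'' : c = -1 := by linarith
      refine ⟨w, Real.pi, hwn, hyw, ?_⟩
      rw [Real.cos_pi, Real.sin_pi, hy₂, hc'', zero_smul, add_zero]
  · have hvn : ‖v‖ ≠ 0 := norm_ne_zero_iff.2 hv0
    have hvpos : 0 < ‖v‖ := norm_pos_iff.2 hv0
    set w : E3 := (r / ‖v‖) • v with hw
    have hwn : ‖w‖ = r := by
      rw [hw, norm_smul, Real.norm_eq_abs, abs_div, abs_of_pos hr, abs_of_nonneg (norm_nonneg _), div_mul_cancel₀ _ hvn]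
    have hyw : ⟪y₁, w⟫ = 0 := by rw [hw, real_inner_smul_right, hv1, mul_zero]
    have hsq : c ^ 2 + (‖v‖ / r) ^ 2 = 1 := by
      field_simp
      linarith [hpy]
    obtain ⟨θ, hcos, hsin⟩ := exists_cos_eq_sin_eq hsq
    refine ⟨w, θ, hwn, hyw, ?_⟩
    rw [hcos, hsin, hw, smul_smul, div_mul_div_cancel₀ hr0, div_self hvn, one_smul, hv]
    abel

/-! ## §2 Vanishing on a sphere ⇒ radial gradient; radial gradient ⇒ constant on the sphere -/

/-- A differentiable function VANISHING on `S_r` (`r > 0`) has radial derivative there: `Dg(y)v = 0` for `|y| = r`, `v ⊥ y`. [folklore] -/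
theorem fderiv_eq_zero_of_vanish_on_sphere {g : E3 → ℝ} {r : ℝ} (hr : 0 < r) (h0 : ∀ y : E3, ‖y‖ = r → g y = 0)
    {y v : E3} (hy : ‖y‖ = r) (hg : DifferentiableAt ℝ g y) (hyv : ⟪y, v⟫ = 0) : fderiv ℝ g y v = 0 := by
  by_cases hv0 : v = 0
  · rw [hv0, map_zero]
  · have hvn : ‖v‖ ≠ 0 := norm_ne_zero_iff.2 hv0
    set w : E3 := (r / ‖v‖) • v with hw
    have hwn : ‖w‖ = r := by
      rw [hw, norm_smul, Real.norm_eq_abs, abs_div, abs_of_pos hr, abs_of_nonneg (norm_nonneg _), div_mul_cancel₀ _ hvn]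
    have hyw : ⟪y, w⟫ = 0 := by rw [hw, real_inner_smul_right, hyv, mul_zero]
    -- `g ∘ γ ≡ 0`
    have hγ0 : Real.cos 0 • y + Real.sin 0 • w = y := by rw [Real.cos_zero, Real.sin_zero, one_smul, zero_smul, add_zero]
    have hcomp : HasDerivAt (fun s : ℝ => g (Real.cos s • y + Real.sin s • w)) (fderiv ℝ g y (-Real.sin 0 • y + Real.cos 0 • w)) 0 := by
      have hg' : HasFDerivAt g (fderiv ℝ g (Real.cos 0 • y + Real.sin 0 • w)) (Real.cos 0 • y + Real.sin 0 • w) := by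
        rw [hγ0]; exact hg.hasFDerivAt
      have h := hg'.comp_hasDerivAt (0 : ℝ) (hasDerivAt_gamma y w 0)
      rw [hγ0] at h
      exact h
    have hzero : (fun s : ℝ => g (Real.cos s • y + Real.sin s • w)) = fun _ => (0 : ℝ) := by
      funext s
      exact h0 _ (norm_greatCircle hy hwn hyw s)
    rw [hzero] at hcomp
    have h1 : fderiv ℝ g y (-Real.sin 0 • y + Real.cos 0 • w) = 0 := hcomp.unique (hasDerivAt_const (0 : ℝ) (0 : ℝ))
    rw [Real.sin_zero, Real.cos_zero, neg_zero, zero_smul, zero_add, one_smul, hw, map_smul, smul_eq_mul] at h1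
    rcases mul_eq_zero.1 h1 with h1 | h1
    · exact absurd h1 (div_ne_zero hr.ne' hvn)
    · exact h1

/-- RADIAL GRADIENT KILLS TANGENT VECTORS: if `∇f(y) × y = 0` with `y ≠ 0` then `Df(y)v = 0` for every `v ⊥ y`
(BAC–CAB: `y × (∇f × y) = |y|²∇f − ⟪y,∇f⟫y`). [folklore] -/
theorem fderiv_eq_zero_of_cross_gradient_eq_zero {f : E3 → ℝ} {y v : E3} (hy : y ≠ 0) (hrad : cross (gradient f y) y = 0)
    (hyv : ⟪y, v⟫ = 0) : fderiv ℝ f y v = 0 := by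
  have hbac : cross y (cross (gradient f y) y) = ⟪y, y⟫ • gradient f y - ⟪y, gradient f y⟫ • y := cross_cross_right _ _ _
  rw [hrad] at hbac
  have hz : cross y (0 : E3) = 0 := by
    ext i
    fin_cases i <;> simp [cross]
  rw [hz] at hbac
  have h1 : ⟪y, y⟫ • gradient f y = ⟪y, gradient f y⟫ • y := (sub_eq_zero.1 hbac.symm)
  have h2 : ⟪y, y⟫ * ⟪gradient f y, v⟫ = ⟪y, gradient f y⟫ * ⟪y, v⟫ := by
    rw [← real_inner_smul_left, ← real_inner_smul_left, h1]
  rw [hyv, mul_zero] at h2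
  have hyy : ⟪y, y⟫ ≠ 0 := by
    rw [real_inner_self_eq_norm_sq]; exact pow_ne_zero 2 (norm_ne_zero_iff.2 hy)
  have h3 : ⟪gradient f y, v⟫ = 0 := (mul_eq_zero.1 h2).resolve_left hyy
  rw [gradient, InnerProductSpace.toDual_symm_apply] at h3
  exact h3

/-- ★ RADIAL GRADIENT ON A SPHERE ⇒ CONSTANT ON THE SPHERE: if `f` is differentiable at every point of `S_r` (`r > 0`) and `∇f(y) × y = 0`
for `|y| = r`, then `f y₁ = f y₂` for all `y₁, y₂ ∈ S_r` (zero derivative along great-circle arcs, which join any two points). [folklore] -/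
theorem eq_of_cross_gradient_eq_zero_on_sphere {f : E3 → ℝ} {r : ℝ} (hr : 0 < r)
    (hf : ∀ y : E3, ‖y‖ = r → DifferentiableAt ℝ f y) (hrad : ∀ y : E3, ‖y‖ = r → cross (gradient f y) y = 0)
    {y₁ y₂ : E3} (h₁ : ‖y₁‖ = r) (h₂ : ‖y₂‖ = r) : f y₁ = f y₂ := by
  obtain ⟨w, θ, hw, hyw, hy₂⟩ := exists_greatCircle_through hr h₁ h₂
  -- `t ↦ f(γ t)` has zero derivative
  set g : ℝ → ℝ := fun s => f (Real.cos s • y₁ + Real.sin s • w) with hg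
  have hder : ∀ t : ℝ, HasDerivAt g 0 t := by
    intro t
    have hγt : ‖Real.cos t • y₁ + Real.sin t • w‖ = r := norm_greatCircle h₁ hw hyw t
    have hne : Real.cos t • y₁ + Real.sin t • w ≠ 0 := by
      rw [← norm_ne_zero_iff, hγt]; exact hr.ne'
    have h := (hf _ hγt).hasFDerivAt.comp_hasDerivAt t (hasDerivAt_gamma y₁ w t)
    have h0 : fderiv ℝ f (Real.cos t • y₁ + Real.sin t • w) (-Real.sin t • y₁ + Real.cos t • w) = 0 :=
      fderiv_eq_zero_of_cross_gradient_eq_zero hne (hrad _ hγt) (inner_greatCircle_velocity h₁ hw hyw t)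
    rw [h0] at h
    exact h
  have hdiff : Differentiable ℝ g := fun t => (hder t).differentiableAt
  have hconst := is_const_of_deriv_eq_zero hdiff (fun t => (hder t).deriv) 0 θ
  have hg0 : g 0 = f y₁ := by
    simp only [hg, Real.cos_zero, Real.sin_zero, one_smul, zero_smul, add_zero]
  have hgθ : g θ = f y₂ := by rw [hg, hy₂]
  rw [← hg0, ← hgθ, hconst]

end Summit.NavierStokesRegularity.NavierStokesRegularity.Theorems.UnthreadedRigidity.Persistence

end
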